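import Literature.NumberTheory.LFunctions.RealCharacterPartialSums
import Mathlib.NumberTheory.ArithmeticFunction.Misc
import HarnessLib

/-!
# `∑_{n ≤ x} (1 ∗ χ)(n) = L(1, χ) x + O(q √x)` for a real Dirichlet character `χ`

Topic `Literature/NumberTheory/LFunctions`, continuing `RealCharacterPartialSums.lean`
(`reChar χ`, the tail bound `|L(1,χ) − ∑_{n ≤ t} χ(n)/n| ≤ 2q/t`). Everything is PROVED and
elementary (Dirichlet's hyperbola method with the crude bound `|∑_{y < a ≤ M} χ(a)| ≤ 2q`):

* `RealChar.charDivisorSum χ = r = χ ∗ 1`, `r(n) = ∑_{d ∣ n} χ(d)` as a real arithmetic function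
  (the real form of Mathlib's `DirichletCharacter.zetaMul`, `ofReal_charDivisorSum`): for
  quadratic `χ` it is multiplicative and non-negative (`charDivisorSum_nonneg`, Mathlib's
  `DirichletCharacter.zetaMul_nonneg`), `r(p) = 1 + χ(p)`, `r(p^k) = ∑_{j ≤ k} χ(p)^j`,
  `|r(n)| ≤ τ(n)`;
* `RealChar.sum_charDivisorSum_eq` — `∑_{n ≤ N} r(n) = ∑_{a ≤ N} χ(a) ⌊N/a⌋`;
* `RealChar.abs_sum_Ioc_reChar_mul_div_le` — the hyperbola step
  `|∑_{y < a ≤ N} χ(a)⌊N/a⌋| ≤ 2q ⌊N/(y+1)⌋` (swap to `∑_b ∑_{y < a ≤ N/b} χ(a)`);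
* `RealChar.abs_sum_charDivisorSum_sub_le` — **the asymptotic formula**: for quadratic `χ ≠ χ₀`
  mod `q` and every real `t > 0`,
  `|∑_{n ≤ t} r(n) − L(1, χ) t| ≤ 5 q √t`
  (Davenport, *Multiplicative Number Theory*, Ch. 6, the argument around (4); Montgomery–Vaughan
  §4.3, Exercise-level; the classical constant `O(√(q t))` of Pólya–Vinogradov is not needed).

These feed the level-of-distribution computation for `r` (`RealCharacterDivisorSumsLevel.lean`)
and the upper bound for `L(1, χ)` in the presence of an exceptional zero.

## References

* H. Davenport, *Multiplicative Number Theory*, 2nd ed., GTM 74 (1980), Ch. 6. [DavenportMNT1980]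
* H. L. Montgomery, R. C. Vaughan, *Multiplicative Number Theory I*, CUP (2007), §4.3.
  [MontgomeryVaughan2007]
-/

noncomputable section

open Complex Finset ArithmeticFunction
open scoped ArithmeticFunction.zeta ComplexOrder

namespace Literature.NumberTheory.LFunctions.RealChar

open DirichletAbel

variable {q : ℕ} [NeZero q] (χ : DirichletCharacter ℂ q)

/-! ### Character sums over intervals `(y, M]` -/

omit [NeZero q] in
/-- `∑_{1 ≤ a ≤ M} reChar χ(a) = Re S(M)` (`S` = `DirichletAbel.partialSum`). [folklore] -/
theorem sum_Ioc_reChar_eq (M : ℕ) : ∑ a ∈ Ioc 0 M, reChar χ a = (partialSum χ M).re := by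
  rw [sum_Ioc_eq_sum_range_succ, partialSum, Complex.re_sum]
  exact sum_congr rfl fun n _ => reChar_apply χ (Nat.succ_ne_zero n)

/-- `|∑_{1 ≤ a ≤ M} χ(a)| ≤ q` for `χ ≠ χ₀` (MV (4.23)). [cite: MontgomeryVaughan2007, §4.3 eq. (4.23)] -/
theorem abs_sum_Ioc_zero_reChar_le (hχ : χ ≠ 1) (M : ℕ) : |∑ a ∈ Ioc 0 M, reChar χ a| ≤ q := by
  rw [sum_Ioc_reChar_eq]
  exact (abs_re_le_norm _).trans (norm_partialSum_le χ hχ M)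

/-- `|∑_{y < a ≤ M} χ(a)| ≤ 2q` for `χ ≠ χ₀`. [cite: MontgomeryVaughan2007, §4.3 eq. (4.23)] -/
theorem abs_sum_Ioc_reChar_le (hχ : χ ≠ 1) (y M : ℕ) : |∑ a ∈ Ioc y M, reChar χ a| ≤ 2 * q := by
  have hq0 : (0 : ℝ) ≤ q := Nat.cast_nonneg q
  rcases le_or_gt M y with h | h
  · rw [Finset.Ioc_eq_empty (not_lt.mpr h), sum_empty, abs_zero]
    positivity
  · have hsplit := sum_Ioc_consecutive (fun a => reChar χ a) (Nat.zero_le y) h.le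
    have heq : ∑ a ∈ Ioc y M, reChar χ a =
        ∑ a ∈ Ioc 0 M, reChar χ a - ∑ a ∈ Ioc 0 y, reChar χ a := by linarith
    rw [heq]
    calc |∑ a ∈ Ioc 0 M, reChar χ a - ∑ a ∈ Ioc 0 y, reChar χ a|
        ≤ |∑ a ∈ Ioc 0 M, reChar χ a| + |∑ a ∈ Ioc 0 y, reChar χ a| := abs_sub _ _
      _ ≤ q + q := add_le_add (abs_sum_Ioc_zero_reChar_le χ hχ M) (abs_sum_Ioc_zero_reChar_le χ hχ y)
      _ = 2 * q := by ring

/-! ### The arithmetic function `r = χ ∗ 1` -/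

/-- `charDivisorSum χ = r = χ ∗ 1`: `r(n) = ∑_{d ∣ n} Re χ(d)`, a real arithmetic function
(for quadratic `χ`, the number-of-ideals function of the associated quadratic field; Davenport
Ch. 6, `r(n)` there). [cite: DavenportMNT1980, Ch. 6] -/
def charDivisorSum : ArithmeticFunction ℝ :=
  reChar χ * (ζ : ArithmeticFunction ℝ)

omit [NeZero q] in
/-- `r(n) = ∑_{d ∣ n} reChar χ(d)`. [folklore] -/
theorem charDivisorSum_apply (n : ℕ) : charDivisorSum χ n = ∑ d ∈ n.divisors, reChar χ d :=
  coe_mul_zeta_apply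

omit [NeZero q] in
/-- `r` is the real form of Mathlib's `DirichletCharacter.zetaMul χ` (quadratic `χ`). [folklore] -/
theorem ofReal_charDivisorSum (hq : χ ^ 2 = 1) (n : ℕ) :
    ((charDivisorSum χ n : ℝ) : ℂ) = χ.zetaMul n := by
  rw [charDivisorSum_apply, ofReal_sum, DirichletCharacter.zetaMul, coe_zeta_mul_apply]
  refine sum_congr rfl fun d hd => ?_
  have hd0 : d ≠ 0 := Nat.ne_of_gt (Nat.pos_of_mem_divisors hd)
  rw [ofReal_reChar χ hq hd0]
  simp [toArithmeticFunction, hd0]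

omit [NeZero q] in
/-- **`r(n) ≥ 0`** for quadratic `χ` (Mathlib's `DirichletCharacter.zetaMul_nonneg`).
[cite: DavenportMNT1980, Ch. 6] -/
theorem charDivisorSum_nonneg (hq : χ ^ 2 = 1) (n : ℕ) : 0 ≤ charDivisorSum χ n := by
  have h := DirichletCharacter.zetaMul_nonneg hq n
  rw [← ofReal_charDivisorSum χ hq n] at h
  exact_mod_cast h

omit [NeZero q] in
/-- `r` is multiplicative (quadratic `χ`). [folklore] -/
theorem isMultiplicative_charDivisorSum (hq : χ ^ 2 = 1) : (charDivisorSum χ).IsMultiplicative :=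
  (isMultiplicative_reChar χ hq).mul isMultiplicative_zeta.natCast

omit [NeZero q] in
/-- `r(1) = 1`. [folklore] -/
@[simp] theorem charDivisorSum_one : charDivisorSum χ 1 = 1 := by
  simp [charDivisorSum_apply]

omit [NeZero q] in
/-- `reChar χ (n^k) = (reChar χ n)^k` for `n ≥ 1` (complete multiplicativity). [folklore] -/
theorem reChar_pow (hq : χ ^ 2 = 1) {n : ℕ} (hn : n ≠ 0) (k : ℕ) :
    reChar χ (n ^ k) = reChar χ n ^ k := by
  induction k with
  | zero => simp
  | succ k ih => rw [pow_succ, reChar_mul χ hq (pow_ne_zero k hn) hn, ih, pow_succ]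

omit [NeZero q] in
/-- `r(p^k) = ∑_{j=0}^{k} χ(p)^j` at a prime power. [cite: DavenportMNT1980, Ch. 6] -/
theorem charDivisorSum_prime_pow (hq : χ ^ 2 = 1) {p : ℕ} (hp : p.Prime) (k : ℕ) :
    charDivisorSum χ (p ^ k) = ∑ j ∈ range (k + 1), reChar χ p ^ j := by
  rw [charDivisorSum_apply, Nat.sum_divisors_prime_pow hp]
  exact sum_congr rfl fun j _ => reChar_pow χ hq hp.ne_zero j

omit [NeZero q] in
/-- `r(p) = 1 + χ(p)` at a prime. [cite: DavenportMNT1980, Ch. 6] -/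
theorem charDivisorSum_prime (hq : χ ^ 2 = 1) {p : ℕ} (hp : p.Prime) :
    charDivisorSum χ p = 1 + reChar χ p := by
  have h := charDivisorSum_prime_pow χ hq hp 1
  rw [pow_one] at h
  rw [h, sum_range_succ, sum_range_one, pow_zero, pow_one]

omit [NeZero q] in
/-- `|r(n)| ≤ τ(n)` (the number of divisors). [folklore] -/
theorem abs_charDivisorSum_le (n : ℕ) : |charDivisorSum χ n| ≤ #n.divisors := by
  rw [charDivisorSum_apply]
  calc |∑ d ∈ n.divisors, reChar χ d| ≤ ∑ d ∈ n.divisors, |reChar χ d| := abs_sum_le_sum_abs _ _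
    _ ≤ ∑ _d ∈ n.divisors, (1 : ℝ) := sum_le_sum fun d _ => abs_reChar_le_one χ d
    _ = #n.divisors := by simp

omit [NeZero q] in
/-- `r(n) ≤ τ(n) ≤ n`. [folklore] -/
theorem charDivisorSum_le_self (n : ℕ) : charDivisorSum χ n ≤ n :=
  ((le_abs_self _).trans (abs_charDivisorSum_le χ n)).trans (by exact_mod_cast Nat.card_divisors_le_self n)

/-! ### `∑_{n ≤ N} r(n) = ∑_{a ≤ N} χ(a) ⌊N/a⌋` and the hyperbola step -/

omit [NeZero q] in
/-- `∑_{n ≤ N} r(n) = ∑_{a ≤ N} χ(a) ⌊N/a⌋` (Mathlib's `ArithmeticFunction.sum_Ioc_mul_zeta_eq_sum`).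
[cite: DavenportMNT1980, Ch. 6] -/
theorem sum_charDivisorSum_eq (N : ℕ) :
    ∑ n ∈ Ioc 0 N, charDivisorSum χ n = ∑ a ∈ Ioc 0 N, reChar χ a * ((N / a : ℕ) : ℝ) :=
  sum_Ioc_mul_zeta_eq_sum _ N

/-- A sum over `1 ≤ a ≤ M` of a function vanishing for `a ≤ y` is a sum over `y < a ≤ M`. [folklore] -/
theorem sum_Ioc_ite_lt (f : ℕ → ℝ) (y M : ℕ) :
    ∑ a ∈ Ioc 0 M, (if y < a then f a else 0) = ∑ a ∈ Ioc y M, f a := by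
  rw [← sum_filter]
  congr 1
  ext a
  simp only [mem_filter, mem_Ioc]
  omega

omit [NeZero q] in
/-- The character truncated to `a > y`, as an arithmetic function (auxiliary). [folklore] -/
def reCharAbove (y : ℕ) : ArithmeticFunction ℝ :=
  ⟨fun a => if y < a then reChar χ a else 0, by simp⟩

omit [NeZero q] in
/-- **Hyperbola swap**: `∑_{y < a ≤ N} χ(a)⌊N/a⌋ = ∑_{b ≤ N} ∑_{y < a ≤ N/b} χ(a)` (both count
`χ(a)` over the pairs `ab ≤ N` with `a > y`). [cite: DavenportMNT1980, Ch. 6] -/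
theorem sum_Ioc_reChar_mul_div_eq (y N : ℕ) :
    ∑ a ∈ Ioc y N, reChar χ a * ((N / a : ℕ) : ℝ) =
      ∑ b ∈ Ioc 0 N, ∑ a ∈ Ioc y (N / b), reChar χ a := by
  have h1 : ∑ a ∈ Ioc y N, reChar χ a * ((N / a : ℕ) : ℝ) =
      ∑ n ∈ Ioc 0 N, (reCharAbove χ y * (ζ : ArithmeticFunction ℝ)) n := by
    rw [sum_Ioc_mul_zeta_eq_sum, ← sum_Ioc_ite_lt]
    refine sum_congr rfl fun a _ => ?_
    simp only [reCharAbove, coe_mk]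
    split_ifs <;> simp
  have h2 : ∑ n ∈ Ioc 0 N, (reCharAbove χ y * (ζ : ArithmeticFunction ℝ)) n =
      ∑ n ∈ Ioc 0 N, ((ζ : ArithmeticFunction ℝ) * reCharAbove χ y) n := by
    rw [mul_comm]
  rw [h1, h2, sum_Ioc_mul_eq_sum_sum]
  refine sum_congr rfl fun b hb => ?_
  have hb0 : b ≠ 0 := Nat.ne_of_gt (mem_Ioc.mp hb).1
  rw [natCoe_apply, zeta_apply_ne hb0, Nat.cast_one, one_mul]
  exact sum_Ioc_ite_lt (fun a => reChar χ a) y (N / b)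

/-- **The hyperbola step**: `|∑_{y < a ≤ N} χ(a)⌊N/a⌋| ≤ 2q ⌊N/(y+1)⌋` for `χ ≠ χ₀` mod `q`
(inner character sums are `≤ 2q` in absolute value and vanish once `N/b ≤ y`).
[cite: DavenportMNT1980, Ch. 6] -/
theorem abs_sum_Ioc_reChar_mul_div_le (hχ : χ ≠ 1) (y N : ℕ) :
    |∑ a ∈ Ioc y N, reChar χ a * ((N / a : ℕ) : ℝ)| ≤ 2 * q * ((N / (y + 1) : ℕ) : ℝ) := by
  rw [sum_Ioc_reChar_mul_div_eq]
  set K := N / (y + 1) with hK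
  have hsplit := sum_Ioc_consecutive (fun b => ∑ a ∈ Ioc y (N / b), reChar χ a) (Nat.zero_le K)
    (Nat.div_le_self N (y + 1))
  rw [← hsplit]
  have hzero : ∑ b ∈ Ioc K N, ∑ a ∈ Ioc y (N / b), reChar χ a = 0 := by
    refine sum_eq_zero fun b hb => ?_
    have hKb : K < b := (mem_Ioc.mp hb).1
    have hb0 : 0 < b := lt_of_le_of_lt (Nat.zero_le K) hKb
    have h1 : N < b * (y + 1) := (Nat.div_lt_iff_lt_mul (Nat.succ_pos y)).mp hKb
    have h2 : N / b < y + 1 := by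
      rw [Nat.div_lt_iff_lt_mul hb0, mul_comm]
      exact h1
    rw [Finset.Ioc_eq_empty (by omega), sum_empty]
  rw [hzero, add_zero]
  calc |∑ b ∈ Ioc 0 K, ∑ a ∈ Ioc y (N / b), reChar χ a|
      ≤ ∑ b ∈ Ioc 0 K, |∑ a ∈ Ioc y (N / b), reChar χ a| := abs_sum_le_sum_abs _ _
    _ ≤ ∑ _b ∈ Ioc 0 K, (2 * q : ℝ) := sum_le_sum fun b _ => abs_sum_Ioc_reChar_le χ hχ y (N / b)
    _ = 2 * q * (K : ℝ) := by rw [sum_const, Nat.card_Ioc, nsmul_eq_mul, Nat.sub_zero]; ring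

/-! ### The asymptotic formula for `∑_{n ≤ t} r(n)` -/

/-- `|L(1, χ)| ≤ 3q` for quadratic `χ ≠ χ₀` (from the tail bound at `t = 1`: `|L(1,χ) − 1| ≤ 2q`).
[folklore] -/
theorem abs_re_LFunction_one_le (hχ : χ ≠ 1) (hq : χ ^ 2 = 1) :
    |(χ.LFunction 1).re| ≤ 3 * q := by
  have h := abs_re_LFunction_one_sub_sum_floor_le χ hχ hq one_pos
  rw [Nat.floor_one, div_one] at h
  have hsum : ∑ n ∈ Ioc 0 1, reChar χ n / n = 1 := by
    rw [show Ioc 0 1 = {1} by rfl, sum_singleton, reChar_one, Nat.cast_one, div_one]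
  rw [hsum] at h
  have hq1 : (1 : ℝ) ≤ q := by exact_mod_cast NeZero.one_le
  calc |(χ.LFunction 1).re| = |((χ.LFunction 1).re - 1) + 1| := by ring_nf
    _ ≤ |(χ.LFunction 1).re - 1| + |(1 : ℝ)| := abs_add_le _ _
    _ ≤ 2 * q + 1 := by rw [abs_one]; exact add_le_add h le_rfl
    _ ≤ 3 * q := by linarith

/-- The floor part of the hyperbola method: for real `t ≥ 0`, `N = ⌊t⌋` and a natural number
`a`, `|⌊N/a⌋ − t/a| ≤ 1` (indeed `⌊N/a⌋ = ⌊t/a⌋`; for `a = 0` both quotients are `0`). [folklore] -/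
theorem abs_natDiv_sub_div_le {t : ℝ} (ht : 0 ≤ t) (a : ℕ) :
    |((⌊t⌋₊ / a : ℕ) : ℝ) - t / a| ≤ 1 := by
  rw [← Nat.floor_div_natCast]
  have hta : 0 ≤ t / a := div_nonneg ht (Nat.cast_nonneg a)
  have h1 : ((⌊t / a⌋₊ : ℕ) : ℝ) ≤ t / a := Nat.floor_le hta
  have h2 : t / a < ((⌊t / a⌋₊ : ℕ) : ℝ) + 1 := Nat.lt_floor_add_one _
  rw [abs_le]
  constructor <;> linarith

/-- **`∑_{n ≤ t} r(n) = L(1, χ) t + O(q√t)`**: for a quadratic character `χ ≠ χ₀` mod `q` and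
every real `t > 0`, `|∑_{1 ≤ n ≤ t} r(n) − L(1, χ) t| ≤ 5 q √t`. Proof: with `N = ⌊t⌋`,
`y = ⌊√t⌋`, split `∑_{a ≤ N} χ(a)⌊N/a⌋` at `a = y`; the part `a ≤ y` is
`t ∑_{a ≤ y} χ(a)/a + O(y) = t L(1,χ) + O(2qt/√t + √t)`, the part `a > y` is `O(2q N/(y+1))`
by the hyperbola step. [cite: DavenportMNT1980, Ch. 6, (4)] -/
theorem abs_sum_charDivisorSum_sub_le (hχ : χ ≠ 1) (hq : χ ^ 2 = 1) {t : ℝ} (ht : 0 < t) :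
    |∑ n ∈ Ioc 0 ⌊t⌋₊, charDivisorSum χ n - (χ.LFunction 1).re * t| ≤ 5 * q * Real.sqrt t := by
  set L := (χ.LFunction 1).re with hL
  have hq1 : (1 : ℝ) ≤ q := by exact_mod_cast NeZero.one_le
  have hsq : 0 < Real.sqrt t := Real.sqrt_pos.mpr ht
  have hsqt : Real.sqrt t * Real.sqrt t = t := Real.mul_self_sqrt ht.le
  have hLle : |L| ≤ 3 * q := abs_re_LFunction_one_le χ hχ hq
  rcases lt_or_ge t 1 with ht1 | ht1
  · -- `t < 1`: the sum is empty
    have hfl : ⌊t⌋₊ = 0 := Nat.floor_eq_zero.mpr ht1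
    rw [hfl, show Ioc 0 0 = (∅ : Finset ℕ) by rfl, sum_empty, zero_sub, abs_neg, abs_mul,
      abs_of_pos ht]
    have hts : t ≤ Real.sqrt t := by
      have hs1 : Real.sqrt t ≤ 1 := Real.sqrt_le_one.mpr ht1.le  -- `√t ≤ 1`
      nlinarith
    calc |L| * t ≤ 3 * q * Real.sqrt t := mul_le_mul hLle hts ht.le (by positivity)
      _ ≤ 5 * q * Real.sqrt t := by nlinarith
  · -- `t ≥ 1`
    set N := ⌊t⌋₊ with hN
    set y := ⌊Real.sqrt t⌋₊ with hy
    have hsq1 : 1 ≤ Real.sqrt t := Real.one_le_sqrt.mpr ht1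
    have hy1 : 1 ≤ y := Nat.le_floor (by simpa using hsq1)
    have hyle : (y : ℝ) ≤ Real.sqrt t := Nat.floor_le hsq.le
    have hylt : Real.sqrt t < y + 1 := Nat.lt_floor_add_one _
    have hNle : (N : ℝ) ≤ t := Nat.floor_le ht.le
    have hsqt' : Real.sqrt t ≤ t := by nlinarith
    have hyN : y ≤ N := Nat.floor_mono hsqt'
    -- split the hyperbola sum at `y`
    rw [sum_charDivisorSum_eq, ← sum_Ioc_consecutive _ (Nat.zero_le y) hyN]
    -- the three pieces
    have hA : |∑ a ∈ Ioc y N, reChar χ a * ((N / a : ℕ) : ℝ)| ≤ 2 * q * Real.sqrt t := by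
      refine (abs_sum_Ioc_reChar_mul_div_le χ hχ y N).trans ?_
      have h1 : ((N / (y + 1) : ℕ) : ℝ) ≤ (N : ℝ) / ((y + 1 : ℕ) : ℝ) := Nat.cast_div_le
      have h2 : (N : ℝ) / ((y + 1 : ℕ) : ℝ) ≤ Real.sqrt t := by
        rw [div_le_iff₀ (by positivity)]
        push_cast
        nlinarith
      have : (0 : ℝ) ≤ 2 * q := by positivity
      exact mul_le_mul_of_nonneg_left (h1.trans h2) this
    have hB : |∑ a ∈ Ioc 0 y, reChar χ a * ((N / a : ℕ) : ℝ) -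
        t * ∑ a ∈ Ioc 0 y, reChar χ a / a| ≤ Real.sqrt t := by
      rw [mul_sum, ← sum_sub_distrib]
      calc |∑ a ∈ Ioc 0 y, (reChar χ a * ((N / a : ℕ) : ℝ) - t * (reChar χ a / a))|
          ≤ ∑ a ∈ Ioc 0 y, |reChar χ a * ((N / a : ℕ) : ℝ) - t * (reChar χ a / a)| :=
            abs_sum_le_sum_abs _ _
        _ ≤ ∑ _a ∈ Ioc 0 y, (1 : ℝ) := by
            refine sum_le_sum fun a _ => ?_
            rw [show reChar χ a * ((N / a : ℕ) : ℝ) - t * (reChar χ a / a) =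
              reChar χ a * (((N / a : ℕ) : ℝ) - t / a) by ring, abs_mul]
            calc |reChar χ a| * |((N / a : ℕ) : ℝ) - t / a| ≤ 1 * 1 :=
                  mul_le_mul (abs_reChar_le_one χ a) (abs_natDiv_sub_div_le ht.le a)
                    (abs_nonneg _) zero_le_one
              _ = 1 := one_mul _
        _ = y := by simp
        _ ≤ Real.sqrt t := hyle
    have hC : |t * ∑ a ∈ Ioc 0 y, reChar χ a / a - L * t| ≤ 2 * q * Real.sqrt t := by
      have h := abs_re_LFunction_one_sub_sum_floor_le χ hχ hq hsq
      rw [← hy] at h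
      rw [show t * ∑ a ∈ Ioc 0 y, reChar χ a / a - L * t =
        t * -(L - ∑ a ∈ Ioc 0 y, reChar χ a / a) by ring, abs_mul, abs_neg, abs_of_pos ht]
      calc t * |L - ∑ a ∈ Ioc 0 y, reChar χ a / a| ≤ t * (2 * q / Real.sqrt t) :=
            mul_le_mul_of_nonneg_left h ht.le
        _ = 2 * q * Real.sqrt t := by
            field_simp
            nlinarith
    -- combine
    have key : ∑ a ∈ Ioc 0 y, reChar χ a * ((N / a : ℕ) : ℝ) +
        ∑ a ∈ Ioc y N, reChar χ a * ((N / a : ℕ) : ℝ) - L * t =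
        (∑ a ∈ Ioc 0 y, reChar χ a * ((N / a : ℕ) : ℝ) - t * ∑ a ∈ Ioc 0 y, reChar χ a / a) +
        (t * ∑ a ∈ Ioc 0 y, reChar χ a / a - L * t) +
        ∑ a ∈ Ioc y N, reChar χ a * ((N / a : ℕ) : ℝ) := by ring
    rw [key]
    calc _ ≤ |(∑ a ∈ Ioc 0 y, reChar χ a * ((N / a : ℕ) : ℝ) - t * ∑ a ∈ Ioc 0 y, reChar χ a / a) +
          (t * ∑ a ∈ Ioc 0 y, reChar χ a / a - L * t)| +
          |∑ a ∈ Ioc y N, reChar χ a * ((N / a : ℕ) : ℝ)| := abs_add_le _ _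
      _ ≤ (Real.sqrt t + 2 * q * Real.sqrt t) + 2 * q * Real.sqrt t :=
          add_le_add ((abs_add_le _ _).trans (add_le_add hB hC)) hA
      _ ≤ 5 * q * Real.sqrt t := by nlinarith

end Literature.NumberTheory.LFunctions.RealChar
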